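import Summits.Ventures.HSemireg.WedgeHankelClassSpaceIrreducibleSL2

/-!
# Venture HSemireg — THE TWO FAMILIES OF SHEARS GENERATE: a subspace of th-7's class space stable under every upper shear `SbC(1 λ 0 1)` and every lower shear `SbC(1 0 c 1)` is
# stable under the quarter turn, under the unimodular torus `SbC(t⁻¹ 0 0 t)`, indeed under EVERY unimodular substitution (`αδ − βγ = 1`; Whitehead's factorisations); hence
# the sharp criterion of K3/K20 holds for the shears alone in EVERY characteristic: irreducible under the shears ⇔ every `C(n,j)` is a unit (J-leaf needed `n! ≠ 0`)

HONEST FRAMING. Part of the Lean index of the computation cell `pub-hsemireg` (seat p10 gen 22, Sunday typer «UNIFORM-IN-n»).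
Finite-dimensional EXTERIOR ALGEBRA + linear algebra ONLY: no variety, no cohomology theory, no sheaf, no Ext group, no semiregularity map;
nothing here says that HC / HC_CM / HC_AV holds; no Literature fact is declared or used.  Custodian versions as in `WedgeHankelSiegelIdeal` (1/3) and `WedgeHankelFrameChange`;
the dictionary (`SL₂(K)` is generated by its two root subgroups; `Sym^n` as a module over them) is QUOTED, never asserted.

WHAT IS IN THE TREE.  K20 (`WedgeHankelClassSpaceIrreducibleSL2`): `eq_top_of_sl_torus_shear_quarter_stable`, `forall_SL2_stable_eq_top_iff_choose_ne_zero` (with `t ≠ 0`, `(t²)^0, …, (t²)^n`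
distinct), `exists_sq_pow_injective_of_infinite`, `SbC_stable_of_smul_stable`; K3 `SbC_mem_comap_siegel` / `comap_siegel_ne_top` / `comap_siegel_eq_bot_iff`; J-leaf
`eq_top_of_unipotent_stable` (`SbC(1 1 0 1)` and `SbC(1 0 1 1)` suffice when `n! ≠ 0`); J5 `SbC_mul` (`SbC(g′)·SbC(g) = SbC(g·g′)`).  THIS FILE (namespace
`Summit.Ventures.HSemireg.Wedge.HankelFrameChange` continued; imports K20):
* §322 PRODUCTS: `SbC_prod_stable` (stable under `SbC g` and `SbC g′` ⇒ stable under `SbC(g·g′)`), `SbC_stable_of_eq`, **`SbC_quarter_stable_of_shears_stable`**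
  (`(0 −1; 1 0) = U(−1)·L(1)·U(−1)`), `SbC_antidiag_stable_of_shears_stable` (`(0 s; −s′ 0) = U(s)·L(−s′)·U(s)`, `ss′ = 1`), **`SbC_sl_torus_stable_of_shears_stable`**
  (`(s 0; 0 s′) = (0 s; −s′ 0)·(0 −1; 1 0)`),
  **`SbC_stable_of_shears_stable_of_det_eq_one`** (EVERY unimodular `g`: `γ ≠ 0`: `g = U((α−1)/γ)·L(γ)·U((δ−1)/γ)`; `γ = 0`: `g = (α 0; 0 α⁻¹)·U(β/α)`),
  `forall_SL2_stable_iff_forall_shears_stable`.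
* §323 THE CRITERION FOR THE SHEARS: **`eq_top_of_forall_shears_stable_of_choose_ne_zero`** (all `C(n,j)` units, `t ≠ 0` with `(t²)^0, …, (t²)^n` distinct: a non-zero subspace
  stable under all upper and lower shears is `⊤`), **`forall_shears_stable_eq_top_iff_choose_ne_zero`**, **`forall_shears_stable_eq_top_iff_choose_ne_zero_of_infinite`** (every
  infinite field: irreducible under the shears ⇔ every `C(n,j) ≠ 0`), `eq_top_of_forall_shears_stable_of_infinite_of_charZero`.
NOT typed here: finitely many shears (over an infinite field of characteristic `p ≤ n` two shears do NOT suffice in general); anything Ext-side.  New names only.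
-/

open Module

namespace Summit.Ventures.HSemireg.Wedge.HankelFrameChange

open Summit.Ventures.HSemireg.Wedge Summit.Ventures.HSemireg.Wedge.Kunneth Summit.Ventures.HSemireg.Wedge.Hankel
  Summit.Ventures.HSemireg.Wedge.BasisFree Summit.Ventures.HSemireg.Wedge.HankelSiegel Summit.Ventures.HSemireg.Wedge.HankelSiegelIdeal
  Summit.Ventures.HSemireg.Wedge.KunnethKernel Summit.Ventures.HSemireg.Wedge.HankelRankOne Summit.Ventures.HSemireg.Wedge.KernelDuality

variable (K : Type*) [Field K] {n : ℕ}

/-! ## §322. Products of shears: the quarter turn, the unimodular torus, every unimodular substitution -/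

/-- **a subspace stable under `SbC g` and `SbC g′` is stable under `SbC(g·g′)`** (`SbC(g·g′) = SbC(g′)·SbC(g)`, J5). -/
theorem SbC_prod_stable {W : Submodule K (spikeSpan K n)} {α β γ δ α' β' γ' δ' : K} (h : ∀ f ∈ W, SbC K α β γ δ f ∈ W) (h' : ∀ f ∈ W, SbC K α' β' γ' δ' f ∈ W) :
    ∀ f ∈ W, SbC K (α * α' + β * γ') (α * β' + β * δ') (γ * α' + δ * γ') (γ * β' + δ * δ') f ∈ W := fun f hf => by
  rw [← SbC_mul, Module.End.mul_apply]; exact h' _ (h f hf)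

/-- rewriting the four entries. -/
theorem SbC_stable_of_eq {W : Submodule K (spikeSpan K n)} {α β γ δ α' β' γ' δ' : K} (h : ∀ f ∈ W, SbC K α β γ δ f ∈ W) (ha : α = α') (hb : β = β') (hc : γ = γ')
    (hd : δ = δ') : ∀ f ∈ W, SbC K α' β' γ' δ' f ∈ W := by
  subst ha hb hc hd; exact h

section Shears

variable {W : Submodule K (spikeSpan K n)} (hU : ∀ lam : K, ∀ f ∈ W, SbC K 1 lam 0 1 f ∈ W) (hL : ∀ c : K, ∀ f ∈ W, SbC K 1 0 c 1 f ∈ W)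
include hU hL

/-- **the quarter turn is a product of three shears: `(0 −1; 1 0) = U(−1)·L(1)·U(−1)`** — a subspace stable under all shears is stable under `SbC(0 −1 1 0)`. -/
theorem SbC_quarter_stable_of_shears_stable : ∀ f ∈ W, SbC K 0 (-1) 1 0 f ∈ W :=
  have h1 : ∀ f ∈ W, SbC K 0 (-1) 1 1 f ∈ W := SbC_stable_of_eq K (SbC_prod_stable K (hU (-1)) (hL 1)) (by ring) (by ring) (by ring) (by ring)
  SbC_stable_of_eq K (SbC_prod_stable K h1 (hU (-1))) (by ring) (by ring) (by ring) (by ring)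

/-- the antidiagonal `(0 s; −s′ 0) = U(s)·L(−s′)·U(s)` for `s·s′ = 1`: stable under all shears ⇒ stable under `SbC(0 s −s′ 0)`. -/
theorem SbC_antidiag_stable_of_shears_stable {s s' : K} (hs : s * s' = 1) : ∀ f ∈ W, SbC K 0 s (-s') 0 f ∈ W :=
  have h1 : ∀ f ∈ W, SbC K 0 s (-s') 1 f ∈ W :=
    SbC_stable_of_eq K (SbC_prod_stable K (hU s) (hL (-s'))) (by linear_combination (-1 : K) * hs) (by ring) (by ring) (by ring)
  SbC_stable_of_eq K (SbC_prod_stable K h1 (hU s)) (by ring) (by ring) (by ring) (by linear_combination (-1 : K) * hs)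

/-- **the unimodular torus `(s 0; 0 s′) = (0 s; −s′ 0)·(0 −1; 1 0)` (`s·s′ = 1`): stable under all shears ⇒ stable under `SbC(s 0 0 s′)`.** -/
theorem SbC_sl_torus_stable_of_shears_stable {s s' : K} (hs : s * s' = 1) : ∀ f ∈ W, SbC K s 0 0 s' f ∈ W :=
  SbC_stable_of_eq K (SbC_prod_stable K (SbC_antidiag_stable_of_shears_stable K hU hL hs) (SbC_quarter_stable_of_shears_stable K hU hL))
    (by ring) (by ring) (by ring) (by ring)

/-- **EVERY UNIMODULAR SUBSTITUTION IS A PRODUCT OF SHEARS**: `αδ − βγ = 1` ⇒ a subspace stable under all upper and lower shears is stable under `SbC(α β γ δ)` (`γ ≠ 0`: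
`g = U((α−1)/γ)·L(γ)·U((δ−1)/γ)`; `γ = 0`: `g = (α 0; 0 δ)·U(β/α)` with `αδ = 1`). -/
theorem SbC_stable_of_shears_stable_of_det_eq_one {α β γ δ : K} (hdet : α * δ - β * γ = 1) : ∀ f ∈ W, SbC K α β γ δ f ∈ W := by
  by_cases hγ : γ = 0
  · -- upper triangular: `α δ = 1`
    have hαδ : α * δ = 1 := by rw [hγ, mul_zero, sub_zero] at hdet; exact hdet
    have hα : α ≠ 0 := fun h => by rw [h, zero_mul] at hαδ; exact zero_ne_one hαδ
    exact SbC_stable_of_eq K (SbC_prod_stable K (SbC_sl_torus_stable_of_shears_stable K hU hL hαδ) (hU (β / α))) (by ring)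
      (by rw [mul_comm α (β / α), div_mul_cancel₀ β hα]; ring) (by rw [hγ]; ring) (by ring)
  · -- `γ ≠ 0`: `U((α−1)/γ)·L(γ)·U((δ−1)/γ)`
    have h1 : ∀ f ∈ W, SbC K α ((α - 1) / γ) γ 1 f ∈ W :=
      SbC_stable_of_eq K (SbC_prod_stable K (hU ((α - 1) / γ)) (hL γ)) (by rw [div_mul_cancel₀ _ hγ]; ring) (by ring) (by ring) (by ring)
    exact SbC_stable_of_eq K (SbC_prod_stable K h1 (hU ((δ - 1) / γ))) (by ring) (by field_simp; linear_combination hdet) (by ring)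
      (by rw [mul_div_cancel₀ _ hγ]; ring)

omit hU hL in
/-- hence **stability under all unimodular substitutions is the same as stability under all upper and lower shears.** -/
theorem forall_SL2_stable_iff_forall_shears_stable (W : Submodule K (spikeSpan K n)) :
    (∀ α β γ δ : K, α * δ - β * γ = 1 → ∀ f ∈ W, SbC K α β γ δ f ∈ W) ↔
      (∀ lam : K, ∀ f ∈ W, SbC K 1 lam 0 1 f ∈ W) ∧ (∀ c : K, ∀ f ∈ W, SbC K 1 0 c 1 f ∈ W) :=
  ⟨fun h => ⟨fun lam => h 1 lam 0 1 (by ring), fun c => h 1 0 c 1 (by ring)⟩, fun h _ _ _ _ hd => SbC_stable_of_shears_stable_of_det_eq_one K h.1 h.2 hd⟩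

end Shears

/-! ## §323. The sharp criterion for the shears alone -/

/-- **all `C(n,j)` units in `K`, `t ≠ 0` with `(t²)^0, …, (t²)^n` pairwise distinct: every non-zero subspace of th-7's class space stable under all upper shears `SbC(1 λ 0 1)` and all
lower shears `SbC(1 0 c 1)` is `⊤`** (K20 via the torus `SbC(t⁻¹ 0 0 t)` and the quarter turn, both products of shears). -/
theorem eq_top_of_forall_shears_stable_of_choose_ne_zero (hbin : ∀ j ≤ n, ((n.choose j : ℕ) : K) ≠ 0) {t : K} (ht0 : t ≠ 0)
    (ht : Function.Injective fun q : Fin (n + 1) => (t ^ 2) ^ (q : ℕ)) {W : Submodule K (spikeSpan K n)} (hU : ∀ lam : K, ∀ f ∈ W, SbC K 1 lam 0 1 f ∈ W)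
    (hL : ∀ c : K, ∀ f ∈ W, SbC K 1 0 c 1 f ∈ W) (hW : W ≠ ⊥) : W = ⊤ := by
  exact eq_top_of_sl_torus_shear_quarter_stable K hbin ht0 ht (SbC_sl_torus_stable_of_shears_stable K hU hL (inv_mul_cancel₀ ht0)) (hU 1)
    (SbC_quarter_stable_of_shears_stable K hU hL) hW

/-- **THE SHARP CRITERION FOR THE SHEARS: with such `t`, th-7's class space is irreducible under the two families of shears IFF every `C(n,j)`, `j ≤ n`, is non-zero in `K`**
(«only if»: the Siegel classes are stable under everything). -/
theorem forall_shears_stable_eq_top_iff_choose_ne_zero {t : K} (ht0 : t ≠ 0) (ht : Function.Injective fun q : Fin (n + 1) => (t ^ 2) ^ (q : ℕ)) :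
    (∀ W : Submodule K (spikeSpan K n), (∀ lam : K, ∀ f ∈ W, SbC K 1 lam 0 1 f ∈ W) → (∀ c : K, ∀ f ∈ W, SbC K 1 0 c 1 f ∈ W) → W ≠ ⊥ → W = ⊤) ↔
      ∀ j ≤ n, ((n.choose j : ℕ) : K) ≠ 0 := by
  constructor
  · intro h
    by_contra hbin
    exact comap_siegel_ne_top K (h _ (fun lam f hf => SbC_mem_comap_siegel K 1 lam 0 1 hf) (fun c f hf => SbC_mem_comap_siegel K 1 0 c 1 hf)
      (fun hb => hbin ((comap_siegel_eq_bot_iff K).mp hb)))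
  · intro hbin W hU hL hW
    exact eq_top_of_forall_shears_stable_of_choose_ne_zero K hbin ht0 ht hU hL hW

/-- **OVER EVERY INFINITE FIELD: th-7's class space is irreducible under the upper and lower shears IFF every `C(n,j)` is non-zero in `K`** (every characteristic; the J-leaf's
`n! ≠ 0` version used two shears only). -/
theorem forall_shears_stable_eq_top_iff_choose_ne_zero_of_infinite [Infinite K] :
    (∀ W : Submodule K (spikeSpan K n), (∀ lam : K, ∀ f ∈ W, SbC K 1 lam 0 1 f ∈ W) → (∀ c : K, ∀ f ∈ W, SbC K 1 0 c 1 f ∈ W) → W ≠ ⊥ → W = ⊤) ↔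
      ∀ j ≤ n, ((n.choose j : ℕ) : K) ≠ 0 := by
  obtain ⟨t, ht0, ht⟩ := exists_sq_pow_injective_of_infinite K n
  exact forall_shears_stable_eq_top_iff_choose_ne_zero K ht0 ht

/-- characteristic `0` (infinite `K`): every non-zero subspace stable under all shears is `⊤`. -/
theorem eq_top_of_forall_shears_stable_of_infinite_of_charZero [Infinite K] [CharZero K] {W : Submodule K (spikeSpan K n)}
    (hU : ∀ lam : K, ∀ f ∈ W, SbC K 1 lam 0 1 f ∈ W) (hL : ∀ c : K, ∀ f ∈ W, SbC K 1 0 c 1 f ∈ W) (hW : W ≠ ⊥) : W = ⊤ :=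
  (forall_shears_stable_eq_top_iff_choose_ne_zero_of_infinite K).mpr (fun _ hj => Nat.cast_ne_zero.mpr (Nat.choose_pos hj).ne') W hU hL hW

end Summit.Ventures.HSemireg.Wedge.HankelFrameChange
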